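import Literature.Probability.RandomPlanarGeometry.RectangleConformalMap
import Literature.Probability.RandomPlanarGeometry.ChordalCurveFamily
import HarnessLib

/-!
# Stub `stub_flatRectangle` of line `pin-the-shear` (crux stmt-CriticalPhenomena-14221,
# `Theses.SAWPhaseRetrieval.HexTransfer`)

The line proves that the chordal SLE(8/3) law family has no axis-stretch covariance by a
boundary-scaling argument at a marked point where the domain is locally the upper half-plane.
This file supplies such a domain: the open square `(-1, 1) × (0, 2)` — the Jordan domain
`rectDomain 1 1` (`RectangleConformalMap.lean`) translated by `i` (`JordanDomain.map` along the
similarity `z ↦ z + i`) — with marked boundary parameters `1/8` (the midpoint `0` of the bottom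
side, edge `0` of the counterclockwise boundary polygon) and `5/8` (the midpoint `2i` of the top
side, edge `2`). With `r₀ = 1`: `D ∩ B(0, 1) = ℍ ∩ B(0, 1)`, and for every axis stretch
`Φ(x, y) = (x, s y)`, `s > 0`, the image `Φ(D)` agrees with `ℍ` in `B(0, min r₀ (s r₀))`; the
latter holds for ANY set flat at `0` (`stretch_image_inter_ball`): if `‖Φ z‖ < min r₀ (s r₀)`
then `‖z‖ < r₀` (`norm_lt_of_stretch`), and `Φ` preserves the sign of the imaginary part.

* `norm_sq_stretch`, `norm_lt_of_stretch` : `‖(x, s y)‖² = x² + s² y²` and the ball estimate;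
* `stretch_image_inter_ball` : flatness at `0` is stable under axis stretches;
* `polygonLoop_rectVerts_one_eighth` : the boundary square passes through `(0, -1)` at time `1/8`;
* `stub_flatRectangle` : the registered stub, verbatim.
-/

noncomputable section

namespace Summit.CriticalPhenomena.SAWScalingLimit.Cruxes.HexTransfer.PinTheShear

open MeasureTheory Filter Topology Set
open scoped NNReal ENNReal
open Literature.Probability.RandomPlanarGeometry

/-- The squared norm of the stretched point `(x, s y)`: `x² + s² y²`. [folklore] -/
theorem norm_sq_stretch (s : ℝ) (z : ℂ) :
    ‖(z.re : ℂ) + ((s * z.im : ℝ) : ℂ) * Complex.I‖ ^ 2 = z.re ^ 2 + s ^ 2 * z.im ^ 2 := by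
  rw [Complex.sq_norm, Complex.normSq_apply]
  simp
  ring

/-- If the stretched point `(x, s y)` (`s > 0`) lies in the ball of radius `min r₀ (s r₀)` about
`0`, then `(x, y)` lies in the ball of radius `r₀`: for `s ≤ 1`, `s ‖(x, y)‖ ≤ ‖(x, s y)‖ < s r₀`;
for `s ≥ 1`, `‖(x, y)‖ ≤ ‖(x, s y)‖ < r₀`. [folklore] -/
theorem norm_lt_of_stretch {s r₀ : ℝ} (hs : 0 < s) (z : ℂ)
    (h : ‖(z.re : ℂ) + ((s * z.im : ℝ) : ℂ) * Complex.I‖ < min r₀ (s * r₀)) : ‖z‖ < r₀ := by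
  set w : ℂ := (z.re : ℂ) + ((s * z.im : ℝ) : ℂ) * Complex.I with hw
  have hw2 : ‖w‖ ^ 2 = z.re ^ 2 + s ^ 2 * z.im ^ 2 := norm_sq_stretch s z
  have hz2 : ‖z‖ ^ 2 = z.re ^ 2 + z.im ^ 2 := by
    rw [Complex.sq_norm, Complex.normSq_apply]; ring
  have hw0 : 0 ≤ ‖w‖ := norm_nonneg w
  have hr₀ : 0 < r₀ := hw0.trans_lt (h.trans_le (min_le_left _ _))
  refine lt_of_pow_lt_pow_left₀ 2 hr₀.le ?_
  rcases le_total s 1 with hs1 | hs1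
  · have h1 : ‖w‖ < s * r₀ := lt_of_lt_of_le h (min_le_right _ _)
    have h2 : ‖w‖ ^ 2 < (s * r₀) ^ 2 := pow_lt_pow_left₀ h1 hw0 two_ne_zero
    have h3 : s ^ 2 * ‖z‖ ^ 2 ≤ ‖w‖ ^ 2 := by
      rw [hw2, hz2]
      have : s ^ 2 ≤ 1 := pow_le_one₀ hs.le hs1
      nlinarith [sq_nonneg z.re]
    have h4 : s ^ 2 * ‖z‖ ^ 2 < s ^ 2 * r₀ ^ 2 := by
      rw [mul_pow] at h2
      exact lt_of_le_of_lt h3 h2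
    exact lt_of_mul_lt_mul_left h4 (sq_nonneg s)
  · have h1 : ‖w‖ < r₀ := lt_of_lt_of_le h (min_le_left _ _)
    have h2 : ‖w‖ ^ 2 < r₀ ^ 2 := pow_lt_pow_left₀ h1 hw0 two_ne_zero
    have h3 : ‖z‖ ^ 2 ≤ ‖w‖ ^ 2 := by
      rw [hw2, hz2]
      have : 1 ≤ s ^ 2 := one_le_pow₀ hs1
      nlinarith [sq_nonneg z.im]
    exact lt_of_le_of_lt h3 h2

/-- **Flatness at `0` is stable under axis stretches.** If `S` agrees with the upper half-plane
in `B(0, r₀)`, then for the axis stretch `Φ(x, y) = (x, s y)` (`s > 0`) the image `Φ(S)` agrees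
with the upper half-plane in `B(0, min r₀ (s r₀))`: a point `w` of that ball is `Φ z` with
`‖z‖ < r₀` (`norm_lt_of_stretch`), and `w ∈ Φ(S) ↔ z ∈ S ↔ 0 < im z ↔ 0 < im w = s im z`.
[folklore] -/
theorem stretch_image_inter_ball {S : Set ℂ} {r₀ s : ℝ} (hs : 0 < s)
    (hS : S ∩ Metric.ball (0 : ℂ) r₀ =
      UpperHalfPlane.upperHalfPlaneSet ∩ Metric.ball (0 : ℂ) r₀)
    (Φ : ℂ ≃ₜ ℂ) (hΦ : ∀ z : ℂ, Φ z = (z.re : ℂ) + ((s * z.im : ℝ) : ℂ) * Complex.I) :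
    Φ '' S ∩ Metric.ball (0 : ℂ) (min r₀ (s * r₀)) =
      UpperHalfPlane.upperHalfPlaneSet ∩ Metric.ball (0 : ℂ) (min r₀ (s * r₀)) := by
  ext w
  simp only [mem_inter_iff, mem_ball_zero_iff, mem_image]
  constructor
  · rintro ⟨⟨z, hzS, rfl⟩, hw⟩
    refine ⟨?_, hw⟩
    rw [hΦ] at hw ⊢
    have hz : ‖z‖ < r₀ := norm_lt_of_stretch hs z hw
    have hzH : z ∈ S ∩ Metric.ball (0 : ℂ) r₀ := ⟨hzS, mem_ball_zero_iff.2 hz⟩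
    rw [hS] at hzH
    have him : 0 < z.im := hzH.1
    show 0 < ((z.re : ℂ) + ((s * z.im : ℝ) : ℂ) * Complex.I).im
    simpa using mul_pos hs him
  · rintro ⟨hwH, hw⟩
    have hwH' : 0 < w.im := hwH
    have hzw : ((((⟨w.re, w.im / s⟩ : ℂ).re : ℝ) : ℂ) +
        ((s * (⟨w.re, w.im / s⟩ : ℂ).im : ℝ) : ℂ) * Complex.I) = w := by
      apply Complex.ext <;> simp [mul_div_cancel₀ _ hs.ne']
    refine ⟨⟨⟨w.re, w.im / s⟩, ?_, by rw [hΦ, hzw]⟩, hw⟩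
    have hz : ‖(⟨w.re, w.im / s⟩ : ℂ)‖ < r₀ := norm_lt_of_stretch hs _ (by rw [hzw]; exact hw)
    have hzH : (⟨w.re, w.im / s⟩ : ℂ) ∈
        UpperHalfPlane.upperHalfPlaneSet ∩ Metric.ball (0 : ℂ) r₀ :=
      ⟨show 0 < w.im / s from div_pos hwH' hs, mem_ball_zero_iff.2 hz⟩
    rw [← hS] at hzH
    exact hzH.1

/-- The boundary square of `rectDomain 1 1` (counterclockwise from `(-1, -1)`, four edges of
time-length `1/4`) passes through the bottom-side midpoint `(0, -1)` at time `1/8`. [folklore] -/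
theorem polygonLoop_rectVerts_one_eighth :
    polygonLoop (rectVerts (1 : ℝ) 1) (1 / 8 : ℝ) = ⟨0, -1⟩ := by
  have h := polygonLoop_apply_div (l := rectVerts (1 : ℝ) 1) (k := 0) (by simp) (θ := 1 / 2)
    ⟨by norm_num, by norm_num⟩
  have e : (((0 : ℕ) : ℝ) + 1 / 2) / ((rectVerts (1 : ℝ) 1).length : ℝ) = 1 / 8 := by
    simp only [length_rectVerts]; norm_num
  rw [e] at h
  rw [h]
  apply Complex.ext <;> norm_num [rectVerts, AffineMap.lineMap_apply_module']

/-- **A Dobrushin domain flat at its first marked point, stable under stretches** (stub 4d of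
line `pin-the-shear`). The open square `(-1, 1) × (0, 2)` (`rectDomain 1 1` translated by `i`)
with marked points `0` (parameter `1/8`) and `2i` (parameter `5/8`) has `D.pt 0 = 0`, coincides
with `ℍ` in `B(0, 1)` (`|re w|, |im w| ≤ ‖w‖ < 1`), and so does its image under every axis
stretch `(x, y) ↦ (x, s y)`, `s > 0`, in `B(0, min 1 s)` (`stretch_image_inter_ball`).
[folklore] -/
theorem stub_flatRectangle :
    ∃ (D : DobrushinDomain) (r₀ : ℝ), 0 < r₀ ∧ D.pt 0 = 0 ∧
      D.carrier ∩ Metric.ball (0 : ℂ) r₀ =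
        UpperHalfPlane.upperHalfPlaneSet ∩ Metric.ball (0 : ℂ) r₀ ∧
      ∀ (s : ℝ), 0 < s → ∀ Φ : ℂ ≃ₜ ℂ,
        (∀ z : ℂ, Φ z = (z.re : ℂ) + ((s * z.im : ℝ) : ℂ) * Complex.I) →
        (D.map Φ).carrier ∩ Metric.ball (0 : ℂ) (min r₀ (s * r₀)) =
          UpperHalfPlane.upperHalfPlaneSet ∩ Metric.ball (0 : ℂ) (min r₀ (s * r₀)) := by
  -- the square `(-1, 1) × (0, 2)` with marked parameters `1/8` (point `0`) and `5/8` (point `2i`)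
  let D : DobrushinDomain :=
    { toJordanDomain :=
        (rectDomain 1 1 one_pos one_pos).map (similarity 1 one_ne_zero Complex.I)
      mark := ![1 / 8, 5 / 8]
      strictMono_mark := by
        refine Fin.strictMono_iff_lt_succ.2 fun k ↦ ?_
        fin_cases k
        norm_num
      mark_mem := fun k ↦ by fin_cases k <;> simp <;> norm_num }
  have hflat : D.carrier ∩ Metric.ball (0 : ℂ) 1 =
      UpperHalfPlane.upperHalfPlaneSet ∩ Metric.ball (0 : ℂ) 1 := by
    ext w
    simp only [mem_inter_iff, mem_ball_zero_iff]
    have key : w ∈ D.carrier ↔ w - Complex.I ∈ symRect 1 1 := by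
      change w ∈ (similarity 1 one_ne_zero Complex.I) '' symRect 1 1 ↔ _
      constructor
      · rintro ⟨z, hz, rfl⟩
        simpa using hz
      · intro h
        exact ⟨w - Complex.I, h, by simp⟩
    rw [key, mem_symRect]
    simp only [Complex.sub_re, Complex.sub_im, Complex.I_re, Complex.I_im, sub_zero]
    have hre := abs_le.1 (Complex.abs_re_le_norm w)
    have him := abs_le.1 (Complex.abs_im_le_norm w)
    constructor
    · rintro ⟨⟨-, ⟨h3, -⟩⟩, hw⟩
      exact ⟨show 0 < w.im by linarith, hw⟩
    · rintro ⟨hH, hw⟩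
      have hH' : 0 < w.im := hH
      exact ⟨⟨⟨by linarith [hre.1], by linarith [hre.2]⟩, by linarith, by linarith [him.2]⟩, hw⟩
  refine ⟨D, 1, one_pos, ?_, hflat, fun s hs Φ hΦ ↦ ?_⟩
  · -- `D.pt 0 = polygonLoop (rectVerts 1 1) (1/8) + i = (0, -1) + i = 0`
    change (similarity 1 one_ne_zero Complex.I) (polygonLoop (rectVerts (1 : ℝ) 1) (1 / 8 : ℝ)) = 0
    rw [polygonLoop_rectVerts_one_eighth, similarity_apply]
    apply Complex.ext <;> simp
  · rw [MarkedDomain.carrier_map]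
    exact stretch_image_inter_ball hs hflat Φ hΦ

end Summit.CriticalPhenomena.SAWScalingLimit.Cruxes.HexTransfer.PinTheShear

end
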